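import Summits.Ventures.HSemireg.WedgeHankelRecurrenceGaussZerosGershgorinDiscs

/-!
# Venture HSemireg — **CAUCHY'S INTERLACING THEOREM FOR A CONTIGUOUS BLOCK OF THE RECURRENCE**: let `Q` be the recurrence with the shifted coefficients `(a_{n+r₀}, b_{n+r₀})` (associated
# polynomials of order `r₀`), `r₀ + r' ≤ t`, `x_0 < ⋯ < x_t` the zeros of `q_{t+1}` and `θ_0 < ⋯ < θ_{r'}` those of `Q_{r'+1}`; then `x_m ≤ θ_m ≤ x_{m + t − r'}` for every `m ≤ r'` — the
# eigenvalues of the principal block of rows `r₀, …, r₀ + r'` of the Jacobi matrix interlace those of the whole matrix.  For `r₀ = 0` this is the index form of the interlacing of `q_{r'+1}`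
# and `q_{t+1}` for ANY degree gap (N279 is the gap-one case, N285 the «between two zeros» form)

HONEST FRAMING. Part of the Lean index of the computation cell `pub-hsemireg` (seat p10 gen 45, Sunday typer «UNIFORM-IN-n»).  Real polynomials, finite sums and one rank–nullity count only; no
variety, no cohomology theory, no sheaf, no Ext group and no semiregularity map is constructed here; nothing here says that HC / HC_CM / HC_AV holds; no Literature fact (unproved `Prop`) is declared
or used.  Custodian versions as in `WedgeHankelSiegelIdeal` (1/3).
SOURCES (cited).  A.-L. Cauchy, *Sur l'équation à l'aide de laquelle on détermine les inégalités séculaires des mouvements des planètes* (1829), Œuvres (2) 9, 174–195; R. A. Horn, C. R. Johnson,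
*Matrix Analysis* (2nd ed.) Thm 4.3.28; B. N. Parlett, *The Symmetric Eigenvalue Problem* (1980) §10.1; T. S. Chihara, *An Introduction to Orthogonal Polynomials* (1978) Ch. III §4 (associated
polynomials); for orthogonal polynomials G. Szegő, *Orthogonal Polynomials*, Thm 3.3.2–3.3.3.
PROOF TYPED HERE (no matrices).  Favard pairings at the zeros for `q` (N323) and for `Q`; a coefficient vector `ṽ ∈ ℝ^{r'+1}` is read both as `P = Σ ṽ_n q_{r₀+n}` and as `P̃ = Σ ṽ_n Q_n`, and
the norms and `x`-forms agree up to the factor `h_{r₀} = b_1⋯b_{r₀}`: `Σ μ P² = h_{r₀} Σ μ̃ P̃²`, `Σ μ x P² = h_{r₀} Σ μ̃ θ P̃²` (N323 `favard_x_pairing` for both recurrences and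
`h_{r₀+n} = h_{r₀} h̃_n`); the test vectors with `r'` vanishing conditions (N346 `exists_test_vector_of_card_lt`) give the two inequalities as in N346.
DEDUP DISCLOSURE (`rg -n 'cauchy_interlace|associated_interlace|block' Summits/Ventures/HSemireg/WedgeHankelRecurrenceGauss*`, 2026-09-03): N279 (`recurrence_zeros_interlace`, consecutive degrees),
N285 (`recurrence_zeros_separate`, Szegő 3.3.3), N313 (second-kind zeros) are the neighbours; the block ∕ index form is new.  The 5 names below: 0 hits tree-wide.

WHAT IS IN THE TREE.  N323 `favard_pairing_at_zeros`, `favard_x_pairing`, `weighted_sq_combination_expand`; N325 `prod_Ico_one_succ_succ`; N346 `exists_test_vector_of_card_lt`; N322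
`card_univ_filter_val_ge`; Mathlib `Finset.prod_Ico_consecutive`, `Finset.prod_Ico_add'`, `Fin.card_filter_val_lt`.
THIS FILE (namespace `Summit.Ventures.HSemireg.Wedge.HankelOuter` continued; CHAINED on N355 (import only); 0 definitions):
* §1121 `prod_Ico_one_shift` (`h_{r₀+n} = h_{r₀} · Π_{l=1}^{n} b_{l+r₀}`), **`associated_block_forms`** (norm and `x`-form of `Σ ṽ_n q_{r₀+n}` versus `Σ ṽ_n Q_n`: factor `h_{r₀}`),
  **`associated_block_interlace_lower`** (`x_m ≤ θ_m`), **`associated_block_interlace_upper`** (`θ_m ≤ x_{m+t−r'}`), `associated_block_zeros_mem_hull` (`x_0 ≤ θ_m ≤ x_t`).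
CAVEATS.  Positive recurrences; contiguous blocks only (general principal submatrices have no polynomial description here).  Nothing Ext-side.  New names only.
-/

open Module Polynomial
open scoped Matrix Polynomial

namespace Summit.Ventures.HSemireg.Wedge.HankelOuter

/-! ## §1121. Cauchy interlacing for a contiguous block -/

/-- **`b_1⋯b_{r₀+n} = (b_1⋯b_{r₀}) · Π_{l=1}^{n} b_{l+r₀}`.** [bookkeeping; this file, §1121] -/
theorem prod_Ico_one_shift (b : ℕ → ℝ) (r₀ n : ℕ) :
    ∏ l ∈ Finset.Ico 1 (r₀ + n + 1), b l = (∏ l ∈ Finset.Ico 1 (r₀ + 1), b l) * ∏ l ∈ Finset.Ico 1 (n + 1), b (l + r₀) := by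
  rw [Finset.prod_Ico_add' b 1 (n + 1) r₀, show 1 + r₀ = r₀ + 1 by ring, show n + 1 + r₀ = r₀ + n + 1 by ring,
    Finset.prod_Ico_consecutive b (show 1 ≤ r₀ + 1 by omega) (show r₀ + 1 ≤ r₀ + n + 1 by omega)]

/-- **THE BLOCK FORMS.**  For the recurrence `Q` with coefficients `(a_{n+r₀}, b_{n+r₀})`, Favard pairings `(μ, x)` of `q` at the zeros of `q_{t+1}` and `(μ̃, θ)` of `Q` at the zeros of
`Q_{r'+1}` (`r₀ + r' ≤ t`), and `ṽ ∈ ℝ^{r'+1}`: with `P = Σ ṽ_n q_{r₀+n}`, `P̃ = Σ ṽ_n Q_n` one has `Σ μ P(x)² = h_{r₀} Σ μ̃ P̃(θ)²` and `Σ μ x P(x)² = h_{r₀} Σ μ̃ θ P̃(θ)²`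
(`h_{r₀} = b_1⋯b_{r₀}`). [this file, §1121] -/
theorem associated_block_forms {q Q : ℕ → ℝ[X]} {a b A B : ℕ → ℝ} (hq0 : q 0 = 1) (hq1 : q 1 = Polynomial.X - C (a 0))
    (hrec : ∀ n, q (n + 2) = (Polynomial.X - C (a (n + 1))) * q (n + 1) - C (b (n + 1)) * q n)
    (hQ0 : Q 0 = 1) (hQ1 : Q 1 = Polynomial.X - C (A 0)) (hQrec : ∀ n, Q (n + 2) = (Polynomial.X - C (A (n + 1))) * Q (n + 1) - C (B (n + 1)) * Q n)
    {r₀ : ℕ} (hA : ∀ n, A n = a (n + r₀)) (hB : ∀ n, B n = b (n + r₀)) {t r' : ℕ} (hr : r₀ + r' ≤ t)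
    {μ x : Fin (t + 1) → ℝ} {ν θ : Fin (r' + 1) → ℝ} (hxr : ∀ k, (q (t + 1)).eval (x k) = 0) (hθr : ∀ k, (Q (r' + 1)).eval (θ k) = 0)
    (hpair : ∀ i j : Fin (t + 1), ∑ k, μ k * ((q i).eval (x k) * (q j).eval (x k)) = if i = j then ∏ l ∈ Finset.Ico 1 ((j : ℕ) + 1), b l else 0)
    (hpairQ : ∀ i j : Fin (r' + 1), ∑ k, ν k * ((Q i).eval (θ k) * (Q j).eval (θ k)) = if i = j then ∏ l ∈ Finset.Ico 1 ((j : ℕ) + 1), B l else 0)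
    (w : Fin (r' + 1) → ℝ) :
    ∑ k, μ k * ((∑ n : Fin (r' + 1), C (w n) * q (r₀ + n)).eval (x k)) ^ 2 = (∏ l ∈ Finset.Ico 1 (r₀ + 1), b l) * ∑ k, ν k * ((∑ n : Fin (r' + 1), C (w n) * Q n).eval (θ k)) ^ 2 ∧
    ∑ k, μ k * (x k * ((∑ n : Fin (r' + 1), C (w n) * q (r₀ + n)).eval (x k)) ^ 2) =
      (∏ l ∈ Finset.Ico 1 (r₀ + 1), b l) * ∑ k, ν k * (θ k * ((∑ n : Fin (r' + 1), C (w n) * Q n).eval (θ k)) ^ 2) := by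
  have hev : ∀ z : ℝ, (∑ n : Fin (r' + 1), C (w n) * Q n).eval z = ∑ n : Fin (r' + 1), w n * (Q n).eval z := fun z => by
    rw [eval_finsetSum]; exact Finset.sum_congr rfl fun i _ => by rw [eval_mul, eval_C]
  have hev' : ∀ z : ℝ, (∑ n : Fin (r' + 1), C (w n) * q (r₀ + n)).eval z = ∑ n : Fin (r' + 1), w n * (q (r₀ + n)).eval z := fun z => by
    rw [eval_finsetSum]; exact Finset.sum_congr rfl fun i _ => by rw [eval_mul, eval_C]
  -- the shifted products
  have hH : ∀ n : ℕ, ∏ l ∈ Finset.Ico 1 (r₀ + n + 1), b l = (∏ l ∈ Finset.Ico 1 (r₀ + 1), b l) * ∏ l ∈ Finset.Ico 1 (n + 1), B l := fun n => by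
    rw [prod_Ico_one_shift b r₀ n]; exact congrArg _ (Finset.prod_congr rfl fun l _ => by rw [hB])
  -- the embedded indices
  have hemb : ∀ n : Fin (r' + 1), r₀ + (n : ℕ) < t + 1 := fun n => by have := n.is_lt; omega
  -- pairings at embedded indices
  have hp : ∀ n n' : Fin (r' + 1), ∑ k, μ k * ((q (r₀ + n)).eval (x k) * (q (r₀ + n')).eval (x k)) =
      (∏ l ∈ Finset.Ico 1 (r₀ + 1), b l) * ∑ k, ν k * ((Q n).eval (θ k) * (Q n').eval (θ k)) := fun n n' => by
    have h := hpair ⟨r₀ + n, hemb n⟩ ⟨r₀ + n', hemb n'⟩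
    dsimp only at h
    rw [h, hpairQ]
    by_cases hnn : n = n'
    · subst hnn; rw [if_pos rfl, if_pos rfl, hH]
    · rw [if_neg (fun h' => hnn (Fin.ext (by have := Fin.mk.inj_iff.1 h'; omega))), if_neg hnn, mul_zero]
  have hpx : ∀ n n' : Fin (r' + 1), ∑ k, μ k * (x k * ((q (r₀ + n)).eval (x k) * (q (r₀ + n')).eval (x k))) =
      (∏ l ∈ Finset.Ico 1 (r₀ + 1), b l) * ∑ k, ν k * (θ k * ((Q n).eval (θ k) * (Q n').eval (θ k))) := fun n n' => by
    have h := favard_x_pairing hq0 hq1 hrec hxr hpair ⟨r₀ + n, hemb n⟩ ⟨r₀ + n', hemb n'⟩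
    dsimp only at h
    rw [h, favard_x_pairing hQ0 hQ1 hQrec hθr hpairQ n n', mul_add, mul_add]
    congr 1
    congr 1
    · by_cases h1 : (n : ℕ) + 1 = n'
      · rw [if_pos h1, if_pos (by omega), show r₀ + (n' : ℕ) = r₀ + n' from rfl, hH]
      · rw [if_neg h1, if_neg (by omega), mul_zero]
    · by_cases h2 : (n : ℕ) = n'
      · rw [if_pos h2, if_pos (by omega), hA, hH, show (n : ℕ) + r₀ = r₀ + n by ring]; ring
      · rw [if_neg h2, if_neg (by omega), mul_zero]
    · by_cases h3 : (n : ℕ) = n' + 1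
      · rw [if_pos h3, if_pos (by omega), hH]
      · rw [if_neg h3, if_neg (by omega), mul_zero]
  refine ⟨?_, ?_⟩
  · simp_rw [hev, hev']
    have e1 := weighted_sq_combination_expand μ (fun _ => (1 : ℝ)) (fun (n : Fin (r' + 1)) k => (q (r₀ + n)).eval (x k)) w
    have e2 := weighted_sq_combination_expand ν (fun _ => (1 : ℝ)) (fun (n : Fin (r' + 1)) k => (Q n).eval (θ k)) w
    simp only [one_mul] at e1 e2
    rw [e1, e2, Finset.mul_sum]
    refine Finset.sum_congr rfl fun n _ => ?_
    rw [Finset.mul_sum]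
    refine Finset.sum_congr rfl fun n' _ => ?_
    rw [hp]; ring
  · simp_rw [hev, hev']
    rw [weighted_sq_combination_expand μ x (fun (n : Fin (r' + 1)) k => (q (r₀ + n)).eval (x k)) w,
      weighted_sq_combination_expand ν θ (fun (n : Fin (r' + 1)) k => (Q n).eval (θ k)) w, Finset.mul_sum]
    refine Finset.sum_congr rfl fun n _ => ?_
    rw [Finset.mul_sum]
    refine Finset.sum_congr rfl fun n' _ => ?_
    rw [hpx]; ring

/-- **CAUCHY INTERLACING FOR A CONTIGUOUS BLOCK, LOWER HALF: `x_m ≤ θ_m`** (`m ≤ r'`; `θ` the zeros of `Q_{r'+1}`, `Q` the recurrence with coefficients `(a_{n+r₀}, b_{n+r₀})`, `r₀ + r' ≤ t`).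
[Cauchy 1829; Horn–Johnson Thm 4.3.28; this file, §1121] -/
theorem associated_block_interlace_lower {q Q : ℕ → ℝ[X]} {a b A B : ℕ → ℝ} (hq0 : q 0 = 1) (hq1 : q 1 = Polynomial.X - C (a 0))
    (hrec : ∀ n, q (n + 2) = (Polynomial.X - C (a (n + 1))) * q (n + 1) - C (b (n + 1)) * q n)
    (hQ0 : Q 0 = 1) (hQ1 : Q 1 = Polynomial.X - C (A 0)) (hQrec : ∀ n, Q (n + 2) = (Polynomial.X - C (A (n + 1))) * Q (n + 1) - C (B (n + 1)) * Q n)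
    (hb : ∀ j, 0 < b j) {r₀ : ℕ} (hA : ∀ n, A n = a (n + r₀)) (hB : ∀ n, B n = b (n + r₀)) {t r' : ℕ} (hr : r₀ + r' ≤ t)
    {x : Fin (t + 1) → ℝ} {θ : Fin (r' + 1) → ℝ} (hx : StrictMono x) (hxq : q (t + 1) = ∏ j, (Polynomial.X - C (x j)))
    (hθ : StrictMono θ) (hθq : Q (r' + 1) = ∏ j, (Polynomial.X - C (θ j))) (m : Fin (r' + 1)) :
    x ⟨m, by omega⟩ ≤ θ m := by
  classical
  have hB' : ∀ j, 0 < B j := fun j => by rw [hB]; exact hb _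
  obtain ⟨μ, hμ, hpair⟩ := favard_pairing_at_zeros hq0 hq1 hrec hb hx hxq
  obtain ⟨ν, hν, hpairQ⟩ := favard_pairing_at_zeros hQ0 hQ1 hQrec hB' hθ hθq
  have hxr : ∀ j, (q (t + 1)).eval (x j) = 0 := fun j => by
    rw [hxq, eval_prod]; exact Finset.prod_eq_zero (Finset.mem_univ j) (by rw [eval_sub, eval_X, eval_C, sub_self])
  have hθr : ∀ j, (Q (r' + 1)).eval (θ j) = 0 := fun j => by
    rw [hθq, eval_prod]; exact Finset.prod_eq_zero (Finset.mem_univ j) (by rw [eval_sub, eval_X, eval_C, sub_self])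
  -- the test vector: `m` conditions on the `x`-side below `m`, `r' − m` on the `θ`-side above `m`
  obtain ⟨L, hL⟩ : ∃ L : Finset (Fin (t + 1)), L = Finset.univ.filter (fun j : Fin (t + 1) => (j : ℕ) < m) := ⟨_, rfl⟩
  obtain ⟨U, hU⟩ : ∃ U : Finset (Fin (r' + 1)), U = Finset.univ.filter (fun j : Fin (r' + 1) => (m : ℕ) + 1 ≤ j) := ⟨_, rfl⟩
  have hLcard : L.card = m := by rw [hL, Fin.card_filter_val_lt, min_eq_right (by have := m.is_lt; omega)]
  have hUcard : U.card = r' + 1 - ((m : ℕ) + 1) := by rw [hU]; exact card_univ_filter_val_ge (by have := m.is_lt; omega)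
  obtain ⟨e, he⟩ : ∃ e : L ⊕ U → Fin (r' + 1) → ℝ, e = Sum.elim (fun (j : L) (n : Fin (r' + 1)) => (q (r₀ + n)).eval (x j.1)) (fun (j : U) (n : Fin (r' + 1)) => (Q n).eval (θ j.1)) := ⟨_, rfl⟩
  have hcard : Fintype.card (L ⊕ U) < r' + 1 := by
    rw [Fintype.card_sum, Fintype.card_coe, Fintype.card_coe, hLcard, hUcard]; have := m.is_lt; omega
  obtain ⟨w, hw0, hw⟩ := exists_test_vector_of_card_lt e hcard
  obtain ⟨P, hP⟩ : ∃ P : ℝ[X], P = ∑ n : Fin (r' + 1), C (w n) * q (r₀ + n) := ⟨_, rfl⟩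
  obtain ⟨R, hR⟩ : ∃ R : ℝ[X], R = ∑ n : Fin (r' + 1), C (w n) * Q n := ⟨_, rfl⟩
  have hevP : ∀ z : ℝ, P.eval z = ∑ n : Fin (r' + 1), w n * (q (r₀ + n)).eval z := fun z => by
    rw [hP, eval_finsetSum]; exact Finset.sum_congr rfl fun i _ => by rw [eval_mul, eval_C]
  have hevR : ∀ z : ℝ, R.eval z = ∑ n : Fin (r' + 1), w n * (Q n).eval z := fun z => by
    rw [hR, eval_finsetSum]; exact Finset.sum_congr rfl fun i _ => by rw [eval_mul, eval_C]
  have hPx : ∀ j : Fin (t + 1), (j : ℕ) < m → P.eval (x j) = 0 := fun j hj => by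
    have h := hw (Sum.inl ⟨j, by rw [hL]; exact Finset.mem_filter.2 ⟨Finset.mem_univ _, hj⟩⟩)
    simp only [he, Sum.elim_inl] at h
    rw [hevP, ← h]
  have hRθ : ∀ j : Fin (r' + 1), (m : ℕ) + 1 ≤ j → R.eval (θ j) = 0 := fun j hj => by
    have h := hw (Sum.inr ⟨j, by rw [hU]; exact Finset.mem_filter.2 ⟨Finset.mem_univ _, hj⟩⟩)
    simp only [he, Sum.elim_inr] at h
    rw [hevR, ← h]
  -- forms and norms
  obtain ⟨hN, hF⟩ := associated_block_forms hq0 hq1 hrec hQ0 hQ1 hQrec hA hB hr hxr hθr hpair hpairQ w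
  rw [← hP, ← hR] at hN hF
  have hNQ : ∑ k, ν k * (R.eval (θ k)) ^ 2 = ∑ n : Fin (r' + 1), (∏ l ∈ Finset.Ico 1 ((n : ℕ) + 1), B l) * w n ^ 2 := by
    rw [hR]; exact favard_norm_sq_combination (h := fun n => ∏ l ∈ Finset.Ico 1 (n + 1), B l) hpairQ w
  have hNQpos : 0 < ∑ k, ν k * (R.eval (θ k)) ^ 2 := by
    rw [hNQ]
    obtain ⟨i₀, hi₀⟩ := Function.ne_iff.1 hw0
    exact Finset.sum_pos' (fun i _ => mul_nonneg (Finset.prod_nonneg fun l _ => (hB' l).le) (sq_nonneg _))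
      ⟨i₀, Finset.mem_univ _, mul_pos (Finset.prod_pos fun l _ => hB' l) (sq_pos_iff.2 hi₀)⟩
  have hh : 0 < ∏ l ∈ Finset.Ico 1 (r₀ + 1), b l := Finset.prod_pos fun l _ => hb l
  -- `x_m N_q ≤ F_q` (vanishing below `m` on the `x`-side)
  have h1 : x ⟨m, by omega⟩ * ∑ k, μ k * (P.eval (x k)) ^ 2 ≤ ∑ k, μ k * (x k * (P.eval (x k)) ^ 2) := by
    rw [Finset.mul_sum, ← sub_nonneg, ← Finset.sum_sub_distrib]
    refine Finset.sum_nonneg fun k _ => ?_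
    rw [show μ k * (x k * (P.eval (x k)) ^ 2) - x ⟨m, by omega⟩ * (μ k * (P.eval (x k)) ^ 2) = μ k * ((x k - x ⟨m, by omega⟩) * (P.eval (x k)) ^ 2) by ring]
    by_cases hkm : (k : ℕ) < m
    · rw [hPx k hkm, sq, mul_zero, mul_zero, mul_zero]
    · exact mul_nonneg (hμ k).le (mul_nonneg (sub_nonneg.2 (hx.monotone (Fin.le_def.2 (by push Not at hkm; exact hkm)))) (sq_nonneg _))
  -- `F_Q ≤ θ_m N_Q` (vanishing above `m` on the `θ`-side)
  have h2 : ∑ k, ν k * (θ k * (R.eval (θ k)) ^ 2) ≤ θ m * ∑ k, ν k * (R.eval (θ k)) ^ 2 := by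
    rw [Finset.mul_sum, ← sub_nonneg, ← Finset.sum_sub_distrib]
    refine Finset.sum_nonneg fun k _ => ?_
    rw [show θ m * (ν k * (R.eval (θ k)) ^ 2) - ν k * (θ k * (R.eval (θ k)) ^ 2) = ν k * ((θ m - θ k) * (R.eval (θ k)) ^ 2) by ring]
    by_cases hkm : (m : ℕ) + 1 ≤ k
    · rw [hRθ k hkm, sq, mul_zero, mul_zero, mul_zero]
    · exact mul_nonneg (hν k).le (mul_nonneg (sub_nonneg.2 (hθ.monotone (Fin.le_def.2 (by push Not at hkm; omega)))) (sq_nonneg _))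
  -- the chain
  rw [hN] at h1
  rw [hF] at h1
  have h3 : x ⟨m, by omega⟩ * ((∏ l ∈ Finset.Ico 1 (r₀ + 1), b l) * ∑ k, ν k * (R.eval (θ k)) ^ 2) ≤
      θ m * ((∏ l ∈ Finset.Ico 1 (r₀ + 1), b l) * ∑ k, ν k * (R.eval (θ k)) ^ 2) := by
    calc _ ≤ (∏ l ∈ Finset.Ico 1 (r₀ + 1), b l) * ∑ k, ν k * (θ k * (R.eval (θ k)) ^ 2) := h1
      _ ≤ (∏ l ∈ Finset.Ico 1 (r₀ + 1), b l) * (θ m * ∑ k, ν k * (R.eval (θ k)) ^ 2) := mul_le_mul_of_nonneg_left h2 hh.le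
      _ = _ := by ring
  exact le_of_mul_le_mul_right h3 (mul_pos hh hNQpos)

/-- **CAUCHY INTERLACING FOR A CONTIGUOUS BLOCK, UPPER HALF: `θ_m ≤ x_{m + t − r'}`.** [Cauchy 1829; Horn–Johnson Thm 4.3.28; Parlett §10.1; this file, §1121] -/
theorem associated_block_interlace_upper {q Q : ℕ → ℝ[X]} {a b A B : ℕ → ℝ} (hq0 : q 0 = 1) (hq1 : q 1 = Polynomial.X - C (a 0))
    (hrec : ∀ n, q (n + 2) = (Polynomial.X - C (a (n + 1))) * q (n + 1) - C (b (n + 1)) * q n)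
    (hQ0 : Q 0 = 1) (hQ1 : Q 1 = Polynomial.X - C (A 0)) (hQrec : ∀ n, Q (n + 2) = (Polynomial.X - C (A (n + 1))) * Q (n + 1) - C (B (n + 1)) * Q n)
    (hb : ∀ j, 0 < b j) {r₀ : ℕ} (hA : ∀ n, A n = a (n + r₀)) (hB : ∀ n, B n = b (n + r₀)) {t r' : ℕ} (hr : r₀ + r' ≤ t)
    {x : Fin (t + 1) → ℝ} {θ : Fin (r' + 1) → ℝ} (hx : StrictMono x) (hxq : q (t + 1) = ∏ j, (Polynomial.X - C (x j)))
    (hθ : StrictMono θ) (hθq : Q (r' + 1) = ∏ j, (Polynomial.X - C (θ j))) (m : Fin (r' + 1)) :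
    θ m ≤ x ⟨m + (t - r'), by omega⟩ := by
  classical
  have hB' : ∀ j, 0 < B j := fun j => by rw [hB]; exact hb _
  obtain ⟨μ, hμ, hpair⟩ := favard_pairing_at_zeros hq0 hq1 hrec hb hx hxq
  obtain ⟨ν, hν, hpairQ⟩ := favard_pairing_at_zeros hQ0 hQ1 hQrec hB' hθ hθq
  have hxr : ∀ j, (q (t + 1)).eval (x j) = 0 := fun j => by
    rw [hxq, eval_prod]; exact Finset.prod_eq_zero (Finset.mem_univ j) (by rw [eval_sub, eval_X, eval_C, sub_self])
  have hθr : ∀ j, (Q (r' + 1)).eval (θ j) = 0 := fun j => by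
    rw [hθq, eval_prod]; exact Finset.prod_eq_zero (Finset.mem_univ j) (by rw [eval_sub, eval_X, eval_C, sub_self])
  -- the test vector: `m` conditions on the `θ`-side below `m`, `r' − m` on the `x`-side above `m + t − r'`
  obtain ⟨L, hL⟩ : ∃ L : Finset (Fin (r' + 1)), L = Finset.univ.filter (fun j : Fin (r' + 1) => (j : ℕ) < m) := ⟨_, rfl⟩
  obtain ⟨U, hU⟩ : ∃ U : Finset (Fin (t + 1)), U = Finset.univ.filter (fun j : Fin (t + 1) => (m : ℕ) + (t - r') + 1 ≤ j) := ⟨_, rfl⟩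
  have hLcard : L.card = m := by rw [hL, Fin.card_filter_val_lt, min_eq_right m.is_lt.le]
  have hUcard : U.card = t + 1 - ((m : ℕ) + (t - r') + 1) := by rw [hU]; exact card_univ_filter_val_ge (by have := m.is_lt; omega)
  obtain ⟨e, he⟩ : ∃ e : L ⊕ U → Fin (r' + 1) → ℝ, e = Sum.elim (fun (j : L) (n : Fin (r' + 1)) => (Q n).eval (θ j.1)) (fun (j : U) (n : Fin (r' + 1)) => (q (r₀ + n)).eval (x j.1)) := ⟨_, rfl⟩
  have hcard : Fintype.card (L ⊕ U) < r' + 1 := by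
    rw [Fintype.card_sum, Fintype.card_coe, Fintype.card_coe, hLcard, hUcard]; have := m.is_lt; omega
  obtain ⟨w, hw0, hw⟩ := exists_test_vector_of_card_lt e hcard
  obtain ⟨P, hP⟩ : ∃ P : ℝ[X], P = ∑ n : Fin (r' + 1), C (w n) * q (r₀ + n) := ⟨_, rfl⟩
  obtain ⟨R, hR⟩ : ∃ R : ℝ[X], R = ∑ n : Fin (r' + 1), C (w n) * Q n := ⟨_, rfl⟩
  have hevP : ∀ z : ℝ, P.eval z = ∑ n : Fin (r' + 1), w n * (q (r₀ + n)).eval z := fun z => by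
    rw [hP, eval_finsetSum]; exact Finset.sum_congr rfl fun i _ => by rw [eval_mul, eval_C]
  have hevR : ∀ z : ℝ, R.eval z = ∑ n : Fin (r' + 1), w n * (Q n).eval z := fun z => by
    rw [hR, eval_finsetSum]; exact Finset.sum_congr rfl fun i _ => by rw [eval_mul, eval_C]
  have hRθ : ∀ j : Fin (r' + 1), (j : ℕ) < m → R.eval (θ j) = 0 := fun j hj => by
    have h := hw (Sum.inl ⟨j, by rw [hL]; exact Finset.mem_filter.2 ⟨Finset.mem_univ _, hj⟩⟩)
    simp only [he, Sum.elim_inl] at h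
    rw [hevR, ← h]
  have hPx : ∀ j : Fin (t + 1), (m : ℕ) + (t - r') + 1 ≤ j → P.eval (x j) = 0 := fun j hj => by
    have h := hw (Sum.inr ⟨j, by rw [hU]; exact Finset.mem_filter.2 ⟨Finset.mem_univ _, hj⟩⟩)
    simp only [he, Sum.elim_inr] at h
    rw [hevP, ← h]
  obtain ⟨hN, hF⟩ := associated_block_forms hq0 hq1 hrec hQ0 hQ1 hQrec hA hB hr hxr hθr hpair hpairQ w
  rw [← hP, ← hR] at hN hF
  have hNQ : ∑ k, ν k * (R.eval (θ k)) ^ 2 = ∑ n : Fin (r' + 1), (∏ l ∈ Finset.Ico 1 ((n : ℕ) + 1), B l) * w n ^ 2 := by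
    rw [hR]; exact favard_norm_sq_combination (h := fun n => ∏ l ∈ Finset.Ico 1 (n + 1), B l) hpairQ w
  have hNQpos : 0 < ∑ k, ν k * (R.eval (θ k)) ^ 2 := by
    rw [hNQ]
    obtain ⟨i₀, hi₀⟩ := Function.ne_iff.1 hw0
    exact Finset.sum_pos' (fun i _ => mul_nonneg (Finset.prod_nonneg fun l _ => (hB' l).le) (sq_nonneg _))
      ⟨i₀, Finset.mem_univ _, mul_pos (Finset.prod_pos fun l _ => hB' l) (sq_pos_iff.2 hi₀)⟩
  have hh : 0 < ∏ l ∈ Finset.Ico 1 (r₀ + 1), b l := Finset.prod_pos fun l _ => hb l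
  -- `θ_m N_Q ≤ F_Q`
  have h1 : θ m * ∑ k, ν k * (R.eval (θ k)) ^ 2 ≤ ∑ k, ν k * (θ k * (R.eval (θ k)) ^ 2) := by
    rw [Finset.mul_sum, ← sub_nonneg, ← Finset.sum_sub_distrib]
    refine Finset.sum_nonneg fun k _ => ?_
    rw [show ν k * (θ k * (R.eval (θ k)) ^ 2) - θ m * (ν k * (R.eval (θ k)) ^ 2) = ν k * ((θ k - θ m) * (R.eval (θ k)) ^ 2) by ring]
    by_cases hkm : (k : ℕ) < m
    · rw [hRθ k hkm, sq, mul_zero, mul_zero, mul_zero]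
    · exact mul_nonneg (hν k).le (mul_nonneg (sub_nonneg.2 (hθ.monotone (Fin.le_def.2 (by push Not at hkm; exact hkm)))) (sq_nonneg _))
  -- `F_q ≤ x_{m+t−r'} N_q`
  have h2 : ∑ k, μ k * (x k * (P.eval (x k)) ^ 2) ≤ x ⟨m + (t - r'), by omega⟩ * ∑ k, μ k * (P.eval (x k)) ^ 2 := by
    rw [Finset.mul_sum, ← sub_nonneg, ← Finset.sum_sub_distrib]
    refine Finset.sum_nonneg fun k _ => ?_
    rw [show x ⟨m + (t - r'), by omega⟩ * (μ k * (P.eval (x k)) ^ 2) - μ k * (x k * (P.eval (x k)) ^ 2) = μ k * ((x ⟨m + (t - r'), by omega⟩ - x k) * (P.eval (x k)) ^ 2) by ring]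
    by_cases hkm : (m : ℕ) + (t - r') + 1 ≤ k
    · rw [hPx k hkm, sq, mul_zero, mul_zero, mul_zero]
    · exact mul_nonneg (hμ k).le (mul_nonneg (sub_nonneg.2 (hx.monotone (Fin.le_def.2 (by push Not at hkm; change (k : ℕ) ≤ (m : ℕ) + (t - r'); omega)))) (sq_nonneg _))
  rw [hN, hF] at h2
  have h3 : θ m * ((∏ l ∈ Finset.Ico 1 (r₀ + 1), b l) * ∑ k, ν k * (R.eval (θ k)) ^ 2) ≤
      x ⟨m + (t - r'), by omega⟩ * ((∏ l ∈ Finset.Ico 1 (r₀ + 1), b l) * ∑ k, ν k * (R.eval (θ k)) ^ 2) := by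
    calc θ m * ((∏ l ∈ Finset.Ico 1 (r₀ + 1), b l) * ∑ k, ν k * (R.eval (θ k)) ^ 2) = (∏ l ∈ Finset.Ico 1 (r₀ + 1), b l) * (θ m * ∑ k, ν k * (R.eval (θ k)) ^ 2) := by ring
      _ ≤ (∏ l ∈ Finset.Ico 1 (r₀ + 1), b l) * ∑ k, ν k * (θ k * (R.eval (θ k)) ^ 2) := mul_le_mul_of_nonneg_left h1 hh.le
      _ ≤ _ := h2
  exact le_of_mul_le_mul_right h3 (mul_pos hh hNQpos)

/-- **Corollary: all zeros of a contiguous-block polynomial lie in the hull of the zeros of `q_{t+1}`: `x_0 ≤ θ_m ≤ x_t`.** [Cauchy 1829; this file, §1121] -/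
theorem associated_block_zeros_mem_hull {q Q : ℕ → ℝ[X]} {a b A B : ℕ → ℝ} (hq0 : q 0 = 1) (hq1 : q 1 = Polynomial.X - C (a 0))
    (hrec : ∀ n, q (n + 2) = (Polynomial.X - C (a (n + 1))) * q (n + 1) - C (b (n + 1)) * q n)
    (hQ0 : Q 0 = 1) (hQ1 : Q 1 = Polynomial.X - C (A 0)) (hQrec : ∀ n, Q (n + 2) = (Polynomial.X - C (A (n + 1))) * Q (n + 1) - C (B (n + 1)) * Q n)
    (hb : ∀ j, 0 < b j) {r₀ : ℕ} (hA : ∀ n, A n = a (n + r₀)) (hB : ∀ n, B n = b (n + r₀)) {t r' : ℕ} (hr : r₀ + r' ≤ t)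
    {x : Fin (t + 1) → ℝ} {θ : Fin (r' + 1) → ℝ} (hx : StrictMono x) (hxq : q (t + 1) = ∏ j, (Polynomial.X - C (x j)))
    (hθ : StrictMono θ) (hθq : Q (r' + 1) = ∏ j, (Polynomial.X - C (θ j))) (m : Fin (r' + 1)) :
    x 0 ≤ θ m ∧ θ m ≤ x (Fin.last t) :=
  ⟨(hx.monotone (Fin.zero_le _)).trans (associated_block_interlace_lower hq0 hq1 hrec hQ0 hQ1 hQrec hb hA hB hr hx hxq hθ hθq m),
    (associated_block_interlace_upper hq0 hq1 hrec hQ0 hQ1 hQrec hb hA hB hr hx hxq hθ hθq m).trans (hx.monotone (Fin.le_last _))⟩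

end Summit.Ventures.HSemireg.Wedge.HankelOuter
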